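import Summits.Ventures.PercRepro.Coupling

/-!
# Edgewise Boolean transformations of independent blocks; the join law

A configuration on `E ⊕ E` is a pair of independent configurations on `E`.  Applying ONE Boolean
function `φ : Bool → Bool → Bool` edge by edge (`edgewise φ ω e = φ (ω (inl e)) (ω (inr e))`)
gives a configuration on `E` whose law is again a product Bernoulli law, with the edge
probabilities `edgeLaw φ p q e = P(φ(X, Y) = true)` for independent Bernoulli `X ~ p e`,
`Y ~ q e` (`prob_edgewise`).  Special cases: the meet (`edgeLaw_and`, cf. `prob_meetHalves`),
the **join** `joinHalves` with law `p + q - p·q` (`prob_joinHalves`), and the two projections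
(`edgeLaw_fst`, `edgeLaw_snd`).  `prob_sum_elim_edgewise_right` says that transforming the right
block edgewise keeps the pair a product law — so the construction iterates over several blocks.

The lattice coupling of two arbitrary (incomparable) weight vectors built from these pieces is in
`Summits.Ventures.PercRepro.LatticeCoupling`.
-/

namespace PercRepro

open Finset

/-! ### Edgewise transformations -/

section Edgewise

variable {E : Type*}

/-- Apply the Boolean function `φ` edge by edge to the two halves of a configuration on `E ⊕ E`. -/
def edgewise (φ : Bool → Bool → Bool) (ω : Config (E ⊕ E)) : Config E :=
  fun e => φ (ω (Sum.inl e)) (ω (Sum.inr e))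

/-- Value of an edgewise transformation at an edge. -/
@[simp] theorem edgewise_apply (φ : Bool → Bool → Bool) (ω : Config (E ⊕ E)) (e : E) :
    edgewise φ ω e = φ (ω (Sum.inl e)) (ω (Sum.inr e)) := rfl

/-- The meet of the halves is the edgewise `and`. -/
theorem meetHalves_eq_edgewise : (meetHalves : Config (E ⊕ E) → Config E) = edgewise (· && ·) := rfl

/-- The join of the two halves of a configuration on `E ⊕ E`: an edge is open iff it is open in
at least one half. -/
def joinHalves (ω : Config (E ⊕ E)) : Config E := fun e => ω (Sum.inl e) || ω (Sum.inr e)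

/-- Value of the join of the halves at an edge. -/
@[simp] theorem joinHalves_apply (ω : Config (E ⊕ E)) (e : E) :
    joinHalves ω e = (ω (Sum.inl e) || ω (Sum.inr e)) := rfl

/-- The join of the halves is the edgewise `or`. -/
theorem joinHalves_eq_edgewise : (joinHalves : Config (E ⊕ E) → Config E) = edgewise (· || ·) := rfl

/-- The left half is below the join of the halves. -/
theorem left_le_joinHalves (ω : Config (E ⊕ E)) : ω ∘ Sum.inl ≤ joinHalves ω := by
  rw [Config.le_iff]
  intro e h
  simp only [joinHalves_apply, Bool.or_eq_true, Function.comp_apply] at h ⊢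
  exact Or.inl h

/-- The right half is below the join of the halves. -/
theorem right_le_joinHalves (ω : Config (E ⊕ E)) : ω ∘ Sum.inr ≤ joinHalves ω := by
  rw [Config.le_iff]
  intro e h
  simp only [joinHalves_apply, Bool.or_eq_true, Function.comp_apply] at h ⊢
  exact Or.inr h

/-- The join of the halves is a monotone map `Config (E ⊕ E) → Config E`. -/
theorem monotone_joinHalves : Monotone (joinHalves (E := E)) := by
  intro ω ω' h
  rw [Config.le_iff] at h ⊢
  intro e he
  simp only [joinHalves_apply, Bool.or_eq_true] at he ⊢
  exact he.imp (h _) (h _)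

/-- The Bernoulli factor: `p e` if the edge is open, `1 - p e` if it is closed. -/
def bern (p : E → ℝ) (e : E) (a : Bool) : ℝ := if a then p e else 1 - p e

/-- The weight is the product of the Bernoulli factors. -/
theorem weight_eq_prod_bern [Fintype E] (p : E → ℝ) (ω : Config E) :
    weight p ω = ∏ e, bern p e (ω e) := rfl

/-- The edge probability of `edgewise φ` under independent halves with probabilities `p`, `q`:
`P(φ(X, Y) = true)` for `X ~ Bernoulli(p e)`, `Y ~ Bernoulli(q e)`. -/
def edgeLaw (φ : Bool → Bool → Bool) (p q : E → ℝ) (e : E) : ℝ :=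
  ∑ x : Bool × Bool, if φ x.1 x.2 then bern p e x.1 * bern q e x.2 else 0

/-- The four Bernoulli pair factors sum to `1`. -/
theorem sum_bern_mul_bern (p q : E → ℝ) (e : E) :
    ∑ x : Bool × Bool, bern p e x.1 * bern q e x.2 = 1 := by
  unfold bern
  rw [Fintype.sum_prod_type]
  simp
  ring

/-- One-edge factor of the edgewise law: summing the pair factors over the pairs `(a, b)` with
`φ a b = z` gives the Bernoulli factor of `edgeLaw φ p q` at `z`. -/
theorem bool_edgewise_factor (φ : Bool → Bool → Bool) (p q : E → ℝ) (e : E) (z : Bool) :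
    (∑ x : Bool × Bool, if φ x.1 x.2 = z then bern p e x.1 * bern q e x.2 else 0) =
      bern (edgeLaw φ p q) e z := by
  cases z
  · have h := sum_bern_mul_bern p q e
    have hsplit : ∀ x : Bool × Bool, bern p e x.1 * bern q e x.2 =
        (if φ x.1 x.2 = false then bern p e x.1 * bern q e x.2 else 0) +
          (if φ x.1 x.2 = true then bern p e x.1 * bern q e x.2 else 0) := by
      intro x
      cases φ x.1 x.2 <;> simp
    rw [Finset.sum_congr rfl (fun x _ => hsplit x), Finset.sum_add_distrib] at h
    show _ = 1 - edgeLaw φ p q e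
    unfold edgeLaw
    linarith
  · show _ = edgeLaw φ p q e
    rfl

end Edgewise

/-! ### The edgewise law -/

section EdgewiseLaw

variable {E : Type*} [Fintype E] [DecidableEq E]

/-- A map whose fibres have the probabilities of a product weight `Q` pushes the law forward to
`P_Q`: `P(f ∈ A) = P_Q(A)`. -/
theorem prob_preimage_eq_of_fiber {E' : Type*} [Fintype E'] [DecidableEq E'] {P : E' → ℝ}
    {Q : E → ℝ} (f : Config E' → Config E) (hf : ∀ ζ, prob P (f ⁻¹' {ζ}) = weight Q ζ)
    (A : Set (Config E)) : prob P (f ⁻¹' A) = prob Q A := by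
  rw [prob_eq_sum_fiber P f (f ⁻¹' A)]
  conv_rhs => rw [prob]
  refine Finset.sum_congr rfl fun ζ _ => ?_
  by_cases h : ζ ∈ A
  · have hS : f ⁻¹' A ∩ f ⁻¹' {ζ} = f ⁻¹' {ζ} := by
      ext ω
      simp only [Set.mem_inter_iff, Set.mem_preimage, Set.mem_singleton_iff]
      exact ⟨fun h' => h'.2, fun h' => ⟨by rw [h']; exact h, h'⟩⟩
    rw [hS, hf, Set.indicator_of_mem h]
  · have hS : f ⁻¹' A ∩ f ⁻¹' {ζ} = ∅ := by
      ext ω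
      simp only [Set.mem_inter_iff, Set.mem_preimage, Set.mem_singleton_iff,
        Set.mem_empty_iff_false, iff_false, not_and]
      intro h1 h2
      exact h (h2 ▸ h1)
    rw [hS, prob_empty, Set.indicator_of_notMem h]

/-- Fibre form of the **edgewise law**: under the product law `(p, q)` on `E ⊕ E`, the
probability that `edgewise φ` equals `ζ` is the product Bernoulli weight of `ζ` with edge
probabilities `edgeLaw φ p q`. -/
theorem prob_edgewise_fiber (φ : Bool → Bool → Bool) (p q : E → ℝ) (ζ : Config E) :
    prob (Sum.elim p q) (edgewise φ ⁻¹' {ζ}) = weight (edgeLaw φ p q) ζ := by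
  unfold prob
  let ψ : Config (E ⊕ E) ≃ (E → Bool × Bool) :=
    (Equiv.sumArrowEquivProdArrow E E Bool).trans
      (Equiv.arrowProdEquivProdArrow E (fun _ => Bool) (fun _ => Bool)).symm
  rw [Fintype.sum_equiv ψ _ (fun γ => ∏ e, if φ (γ e).1 (γ e).2 = ζ e then
      bern p e (γ e).1 * bern q e (γ e).2 else 0) ?_]
  · rw [weight_eq_prod_bern]
    have hfac : ∀ e, bern (edgeLaw φ p q) e (ζ e) =
        ∑ x : Bool × Bool, if φ x.1 x.2 = ζ e then bern p e x.1 * bern q e x.2 else 0 :=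
      fun e => (bool_edgewise_factor φ p q e (ζ e)).symm
    simp only [hfac]
    rw [Fintype.prod_sum]
  · intro ω
    have hψ : ∀ e, ψ ω e = (ω (Sum.inl e), ω (Sum.inr e)) := fun e => rfl
    simp only [hψ]
    rw [Fintype.prod_ite_zero]
    by_cases h : ω ∈ edgewise φ ⁻¹' {ζ}
    · have h' : ∀ e, φ (ω (Sum.inl e)) (ω (Sum.inr e)) = ζ e := fun e => by
        have hζ : edgewise φ ω = ζ := h
        rw [← hζ]
        rfl
      rw [Set.indicator_of_mem h, if_pos h', weight_sum_elim, weight_eq_prod_bern,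
        weight_eq_prod_bern, ← Finset.prod_mul_distrib]
      rfl
    · have h' : ¬ ∀ e, φ (ω (Sum.inl e)) (ω (Sum.inr e)) = ζ e := by
        intro hall
        apply h
        show edgewise φ ω = ζ
        funext e
        exact hall e
      rw [Set.indicator_of_notMem h, if_neg h']

/-- **The edgewise law**: `P_{(p,q)}(edgewise φ ∈ A) = P_{edgeLaw φ p q}(A)`. -/
theorem prob_edgewise (φ : Bool → Bool → Bool) (p q : E → ℝ) (A : Set (Config E)) :
    prob (Sum.elim p q) (edgewise φ ⁻¹' A) = prob (edgeLaw φ p q) A :=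
  prob_preimage_eq_of_fiber (edgewise φ) (prob_edgewise_fiber φ p q) A

omit [Fintype E] [DecidableEq E] in
/-- The edge law of the meet is the product `p e * q e`. -/
theorem edgeLaw_and (p q : E → ℝ) (e : E) : edgeLaw (· && ·) p q e = p e * q e := by
  simp [edgeLaw, bern, Fintype.sum_prod_type]

omit [Fintype E] [DecidableEq E] in
/-- The edge law of the join is `p e + q e - p e * q e`. -/
theorem edgeLaw_or (p q : E → ℝ) (e : E) : edgeLaw (· || ·) p q e = p e + q e - p e * q e := by
  simp [edgeLaw, bern, Fintype.sum_prod_type]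
  ring

omit [Fintype E] [DecidableEq E] in
/-- The edge law of the first projection is `p`. -/
theorem edgeLaw_fst (p q : E → ℝ) (e : E) : edgeLaw (fun a _ => a) p q e = p e := by
  simp [edgeLaw, bern, Fintype.sum_prod_type]
  ring

omit [Fintype E] [DecidableEq E] in
/-- The edge law of the second projection is `q`. -/
theorem edgeLaw_snd (p q : E → ℝ) (e : E) : edgeLaw (fun _ b => b) p q e = q e := by
  simp [edgeLaw, bern, Fintype.sum_prod_type]
  ring

/-- **The join law**: the join of two independent Bernoulli vectors with parameters `p`, `q` is
Bernoulli with parameters `p e + q e - p e * q e`. -/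
theorem prob_joinHalves (p q : E → ℝ) (A : Set (Config E)) :
    prob (Sum.elim p q) (joinHalves ⁻¹' A) = prob (fun e => p e + q e - p e * q e) A := by
  rw [joinHalves_eq_edgewise, prob_edgewise]
  congr 1
  funext e
  exact edgeLaw_or p q e

/-- Transforming the right block of `F ⊕ (E ⊕ E)` edgewise keeps the pair a product law:
`(ω ∘ inl, edgewise φ (ω ∘ inr))` under `(m, (p, q))` has the law `(m, edgeLaw φ p q)` on
`F ⊕ E`. -/
theorem prob_sum_elim_edgewise_right {F : Type*} [Fintype F] [DecidableEq F]
    (φ : Bool → Bool → Bool) (m : F → ℝ) (p q : E → ℝ) (S : Set (Config (F ⊕ E))) :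
    prob (Sum.elim m (Sum.elim p q))
        {ω | Sum.elim (ω ∘ Sum.inl) (edgewise φ (ω ∘ Sum.inr)) ∈ S} =
      prob (Sum.elim m (edgeLaw φ p q)) S := by
  rw [prob_sum_elim, prob_sum_elim]
  refine Finset.sum_congr rfl fun α _ => ?_
  congr 1
  have hS : {β : Config (E ⊕ E) | Sum.elim α β ∈ {ω : Config (F ⊕ (E ⊕ E)) |
      Sum.elim (ω ∘ Sum.inl) (edgewise φ (ω ∘ Sum.inr)) ∈ S}} =
      edgewise φ ⁻¹' {β' : Config E | Sum.elim α β' ∈ S} := by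
    ext β
    simp
  rw [hS, prob_edgewise]

end EdgewiseLaw

end PercRepro
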